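import Summits.CriticalPhenomena.PercolationContinuityZ3.Theorems.Transplant.SkelPhiRootNegBXT
import Summits.CriticalPhenomena.PercolationContinuityZ3.Theorems.Transplant.SkelPhiRootBridgeData
import Summits.CriticalPhenomena.PercolationContinuityZ3.Theorems.Transplant.SkelNegBParamsResiduals
import Summits.CriticalPhenomena.PercolationContinuityZ3.Theorems.Transplant.SkelNegBParamsRootVals
import Summits.CriticalPhenomena.PercolationContinuityZ3.Theorems.Transplant.SkelNegBParamsRootCasesT
import Summits.CriticalPhenomena.PercolationContinuityZ3.Theorems.Transplant.SkelNegBParamsRootFine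
import Summits.CriticalPhenomena.PercolationContinuityZ3.Theorems.Transplant.SkelNegBParamsRootLam
import Summits.CriticalPhenomena.PercolationContinuityZ3.Theorems.Transplant.SkelNegBParamsRootA
import Summits.CriticalPhenomena.PercolationContinuityZ3.Theorems.Transplant.SkelNegBParamsRootK
import Summits.CriticalPhenomena.PercolationContinuityZ3.Theorems.Transplant.SkelNegBParamsSlotsSU
import Summits.CriticalPhenomena.PercolationContinuityZ3.Theorems.Transplant.SkelNegBParamsSlots
import HarnessLib

/-!
# N1 (the `{±1}` node), (R) column (R7 instantiation, x-directions): **THE ROOT RESIDUE AT EVERY x-DIRECTION AT THE VALUES OF RECORD** —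
# `NegB.rootOblTWAt_negBT_x_R`: `Skel.RootOblTWAt G ((choiceAtOT κ Φ t p (KS.gT 0 gx) (KS.fT 0 fx) (SU exR mx) hC (KS.PR 0 Px)).scheme O q) Φ.Δ κ.δr du` for `du.1 = 0`,
# from `AtQO`, one vertex type and `0 < p < 1` ONLY — the (R6c) theorem of record `rootOblTWAt_negBT_x` (p305514) with EVERY slot/number hypothesis discharged by
# stmt-g14's params ledger (lane INBOX 2026-08-21T20:46:15Z map): kit index `mk := 0`, bridge case split `o_b = o_L` / `o_b ≠ o_L ∧ ℓ_b < 2|h_b|` / `o_b ≠ o_L ∧ 2|h_b| ≤ ℓ_b`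
# (`KS.yLs/yLd/yLt`, `qBs/qBd/qBt`, `Skelφ.bridgeSame/TrSide/TrTop`, `bridgeData_*`), `Nr := KS.NrOf`, `Rπ := NegB.Rπ … (SU exR mx)`, `Rb := NegB.Rb`, the bridge
# inputs at every centre from `inputsExtraAt_of_atQOB` at the bridge pair (`KS.bridge_mem_PR`).

builds on p205010 (kernel theorem, internal audit signed; external expert review pending) — nothing in this file uses p205010; NOTHING is claimed about the open node
`SamePDropOfSkeletonNeg₁` beyond this (R) residue at the x-directions.
Lane `prim-bschramm`, seat `prim-bschramm-p3` (gen 10; design owner + (R) owner); helper file (`--supports stmt-CriticalPhenomena-4575 --as helper`).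
[cite: KozmaNitzan2024, §4 Theorem 6 (pp. 25–31), p. 28 ((32) at the root)] [cite: MartineauTassion2017, §3.2, §4.3]
-/

noncomputable section

open scoped Classical

namespace Summit.CriticalPhenomena.PercolationContinuityZ3.Theorems.Transplant

open MeasureTheory Literature.Probability.Percolation Literature.Probability.LatticeModels SimpleGraph KNCells KNLevels
open Literature.Probability.Percolation.KozmaNitzan.Cells (oth sgOf sgOf_sign stepVec_apply_fst)
open Literature.Barriers.CriticalPhenomena (graphBall mem_graphBall_self graphBall_mono)

namespace PlanarSkeletonNeg

open SkelConc (Consts)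
open Skelφ (oriφ trφ rootFrame pgramPrismFin pgSideHalfW pgTopPieceW)
open Skelφ.StepI (DataN OutO eventNAt)

namespace NegB

open Neg

section AtR

variable {κ : Consts} {V : Type} [DecidableEq V] [Countable V] {G : SimpleGraph V} [G.LocallyFinite] {Φ : PlanarSkeletonNeg G} {t : V} {p : unitInterval}
  {hC : Φ.CylSubcritical p} (gx fx : Neg.FSlot) (Px : PSlot) (mx : GSlot) {O : OutO V} {q : unitInterval}

set_option maxHeartbeats 1600000 in
/-- **THE ROOT RESIDUE AT EVERY x-DIRECTION AT THE VALUES OF RECORD** (see the module docstring). [cite: KozmaNitzan2024, §4 p. 28 ((32) at the root)] -/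
theorem rootOblTWAt_negBT_x_R (hAt : (choiceAtOT κ Φ t p (KS.gT 0 gx) (KS.fT 0 fx) (SU exR mx) hC (KS.PR 0 Px)).AtQO O q) (h1 : Φ.types = {t})
    (hp0 : 0 < (p : ℝ)) (hp1 : (p : ℝ) < 1) (du : MDir) (hd : du.1 = 0) :
    Skel.RootOblTWAt G ((choiceAtOT κ Φ t p (KS.gT 0 gx) (KS.fT 0 fx) (SU exR mx) hC (KS.PR 0 Px)).scheme O q) Φ.Δ κ.δr du := by
  obtain ⟨i, sδ⟩ := du
  change i = 0 at hd
  subst hd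
  -- facts at `AtQO`
  have hAtS := atQOS_of_atQOT hAt
  have hAtB := atQOB_of_atQOS hAtS
  obtain ⟨hF, hq1, hq2, hCq⟩ := factsO_of_atQOS hAtS
  obtain ⟨hm₀k, hk1, hkM₀, hReq, hΛeq⟩ := hF.seed
  have hσ : sgOf ((0 : Fin 2), sδ) = 1 ∨ sgOf ((0 : Fin 2), sδ) = -1 := sgOf_sign _
  have hN : EqNumL κ Φ t p O.merged (KS.gT 0 gx κ Φ t p O.merged) (KS.fT 0 fx κ Φ t p O.merged) := eqNumL_of_atQOS hAtS
  have hκ : (hL κ Φ t p O.merged (KS.gT 0 gx κ Φ t p O.merged) (KS.fT 0 fx κ Φ t p O.merged)).natAbs ≤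
      10 * nL κ Φ t p O.merged (KS.gT 0 gx κ Φ t p O.merged) (KS.fT 0 fx κ Φ t p O.merged) := (clauseL_of_atQOS hAtS).2
  obtain ⟨hEb, hκb⟩ := KS.clauseBR_of_atQOS (mk := 0) hAtS
  have hℓb27 : 27 ≤ KS.ℓBR κ Φ t p O.merged 0 := by
    have h := KS.ℓBR_ge κ Φ t p O.merged 0 _ hEb
    omega
  have hℓb3 : 3 ≤ KS.ℓBR κ Φ t p O.merged 0 := by omega
  have hMB := KS.MB_floorsR κ Φ t p O.merged 0
  have hRF2 := KS.RF2_R κ Φ t p O.merged 0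
  have hMzb : Mu O.merged < KS.nBR κ Φ t p O.merged 0 := lt_of_le_of_lt hMB.2.2 hRF2.2.1
  have hnb : 1 ≤ KS.nBR κ Φ t p O.merged 0 := by have := hRF2.2.1; omega
  have hclrb : (Mu O.merged + 4) * (KS.nBR κ Φ t p O.merged 0 + (KS.hBR κ Φ t p O.merged 0).natAbs) ≤ KS.nBR κ Φ t p O.merged 0 * (KS.ℓBR κ Φ t p O.merged 0 + 1) := by
    have hlay := hEb.2.2.2.1
    have h1 : Mu O.merged + 4 ≤ KS.MBR κ Φ t p O.merged 0 + 1 := by have := hMB.2.1; omega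
    have h2 : ((Mu O.merged + 4 : ℕ) : ℤ) * ((KS.nBR κ Φ t p O.merged 0 + (KS.hBR κ Φ t p O.merged 0).natAbs : ℕ) : ℤ) ≤
        ((KS.MBR κ Φ t p O.merged 0 : ℤ) + 1) * ((KS.nBR κ Φ t p O.merged 0 + (KS.hBR κ Φ t p O.merged 0).natAbs : ℕ) : ℤ) :=
      mul_le_mul_of_nonneg_right (by exact_mod_cast h1) (by positivity)
    exact_mod_cast h2.trans hlay
  have hfloors := floors_exR κ Φ t p O.merged (KS.gT 0 gx κ Φ t p O.merged) (KS.fT 0 fx κ Φ t p O.merged)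
  -- the zone inside a cylinder of the long map
  have hZ : ∀ c, (↑(O.merged.Λ c (Mu O.merged)) : Set V) ⊆ Skelφ.cyl (φL κ Φ t p O.D O.DT O.ori (KS.gT 0 gx κ Φ t p O.merged) (KS.fT 0 fx κ Φ t p O.merged)) c (Mu O.merged) :=
    fun c => by unfold NegB.φL; rw [Skelφ.cyl_oriφ, hΛeq]; exact Skelφ.fatSeq_subset_cyl Φ.frame hC c _
  -- the bridge pair's pieces at every centre, served for `P_q` (both families, all signs)
  have hPb := KS.bridge_mem_PR κ Φ t p O.merged 0 Px
  have hδkit : ∀ {Nr : ℕ}, 0 + 1 + Nr ≤ 1000 → Neg.δI κ Φ ≤ κ.δr (0 + 1 + Nr) ^ 2 := fun hNr =>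
    Neg.δI_le_sq_of_le κ Φ (Neg.δkit_le_δr κ Φ hNr)
  have hservedB : ∀ {Nr : ℕ}, 0 + 1 + Nr ≤ 1000 → ∀ (c : V) (σ' τ' : ℤ), (σ' = 1 ∨ σ' = -1) → (τ' = 1 ∨ τ' = -1) →
      1 - κ.δr (0 + 1 + Nr) ^ 2 < (bondPercolation G q).real (linkIn
        (Skelφ.pgramPrism G (oriφ Φ.φ (O.ori t (KS.MBR κ Φ t p O.merged 0) (KS.nBR κ Φ t p O.merged 0))) c (KS.nBR κ Φ t p O.merged 0) (KS.hBR κ Φ t p O.merged 0)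
          (3 * KS.ℓBR κ Φ t p O.merged 0) (Rb κ Φ t p O.merged)) (O.merged.Λ c O.merged.k)
        (pgSideHalfW G (oriφ Φ.φ (O.ori t (KS.MBR κ Φ t p O.merged 0) (KS.nBR κ Φ t p O.merged 0))) c (KS.nBR κ Φ t p O.merged 0) (KS.hBR κ Φ t p O.merged 0)
          (KS.ℓBR κ Φ t p O.merged 0) (Rb κ Φ t p O.merged) σ' τ')) ∧
      1 - κ.δr (0 + 1 + Nr) ^ 2 < (bondPercolation G q).real (linkIn
        (Skelφ.pgramPrism G (oriφ Φ.φ (O.ori t (KS.MBR κ Φ t p O.merged 0) (KS.nBR κ Φ t p O.merged 0))) c (KS.nBR κ Φ t p O.merged 0) (KS.hBR κ Φ t p O.merged 0)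
          (3 * KS.ℓBR κ Φ t p O.merged 0) (Rb κ Φ t p O.merged)) (O.merged.Λ c O.merged.k)
        (pgTopPieceW G (oriφ Φ.φ (O.ori t (KS.MBR κ Φ t p O.merged 0) (KS.nBR κ Φ t p O.merged 0))) c (KS.nBR κ Φ t p O.merged 0) (KS.hBR κ Φ t p O.merged 0)
          (KS.ℓBR κ Φ t p O.merged 0) (Rb κ Φ t p O.merged) σ' τ' (KS.vBR κ Φ t p O.merged 0))) := by
    intro Nr hNr c σ' τ' hσ' hτ'
    have hI := hδkit hNr
    have ha := inputsExtraAt_of_atQOB hAtB h1 c hPb 0 (Skelφ.sgnU σ') (Skelφ.sgnU τ')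
    have hb := inputsExtraAt_of_atQOB hAtB h1 c hPb 1 (Skelφ.sgnU σ') (Skelφ.sgnU τ')
    rw [Skelφ.StepI.eventNAt_some] at ha hb
    unfold Skelφ.StepI.regionNAt Skelφ.StepI.pieceNAt at ha hb
    rw [if_pos rfl, Skelφ.val_sgnU hσ', Skelφ.val_sgnU hτ'] at ha
    rw [if_neg (by decide), Skelφ.val_sgnU hσ', Skelφ.val_sgnU hτ'] at hb
    exact ⟨lt_of_le_of_lt (by linarith) ha, lt_of_le_of_lt (by linarith) hb⟩
  -- the long map in the two orientation cases of the bridge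
  have hφcase : O.ori t (KS.MBR κ Φ t p O.merged 0) (KS.nBR κ Φ t p O.merged 0) = oL κ Φ t p O.D O.DT O.ori (KS.gT 0 gx κ Φ t p O.merged) (KS.fT 0 fx κ Φ t p O.merged) ∨
      oriφ Φ.φ (O.ori t (KS.MBR κ Φ t p O.merged 0) (KS.nBR κ Φ t p O.merged 0)) =
        trφ (φL κ Φ t p O.D O.DT O.ori (KS.gT 0 gx κ Φ t p O.merged) (KS.fT 0 fx κ Φ t p O.merged)) := by
    unfold NegB.φL
    cases hb : O.ori t (KS.MBR κ Φ t p O.merged 0) (KS.nBR κ Φ t p O.merged 0) <;>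
      cases hl : oL κ Φ t p O.D O.DT O.ori (KS.gT 0 gx κ Φ t p O.merged) (KS.fT 0 fx κ Φ t p O.merged)
    · exact Or.inl rfl
    · exact Or.inr (by rw [Skelφ.oriφ_false, Skelφ.oriφ_true])
    · exact Or.inr (by rw [Skelφ.oriφ_true, Skelφ.oriφ_false, KS.trφ_trφ])
    · exact Or.inl rfl
  -- ### values shared by the three cases
  have hΛ3 := KS.Λ_sdt κ Φ t p O.merged 0 gx fx hN hκ hσ hℓb27
  have hq4s := KS.four_qBs_le κ Φ t p O.merged 0 gx fx
  have hq4dt := KS.four_qBdt_le κ Φ t p O.merged 0 gx fx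
  have hRQ := hRQ_R κ Φ t p O.merged (KS.gT 0 gx κ Φ t p O.merged) (KS.fT 0 fx κ Φ t p O.merged) (SU exR mx) q
  have hRB := hRB_R κ Φ t p O.merged (KS.gT 0 gx κ Φ t p O.merged) (KS.fT 0 fx κ Φ t p O.merged) (SU exR mx) q ((0 : Fin 2), sδ)
  have hRQ' := hRQ'_R κ Φ t p O.merged (KS.gT 0 gx κ Φ t p O.merged) (KS.fT 0 fx κ Φ t p O.merged) (SU exR mx) q ((0 : Fin 2), sδ)
  have hRM := hRM_R κ Φ t p O.merged (KS.gT 0 gx κ Φ t p O.merged) (KS.fT 0 fx κ Φ t p O.merged) (SU exR mx) q ((0 : Fin 2), sδ)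
  have hΛRg := KS.hΛRg_of_atQOS 0 hAtS
  have hkA0 := hkA0_R κ Φ t p O.merged (KS.gT 0 gx κ Φ t p O.merged) (KS.fT 0 fx κ Φ t p O.merged) hN
  have hkA1 := hkA1_R κ Φ t p O.merged (KS.gT 0 gx κ Φ t p O.merged) (KS.fT 0 fx κ Φ t p O.merged) hN
  have hkAQ' := KS.hkAQ_T κ Φ t p O.merged 0 gx (f := (KS.fT 0 fx κ Φ t p O.merged)) hN hκ hkM₀
  have hρπ := fat_le_Rπ κ Φ t p O.merged (KS.gT 0 gx κ Φ t p O.merged) (KS.fT 0 fx κ Φ t p O.merged) exR mx q hC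
  have hRlπ : Rl κ Φ t p O.merged (KS.gT 0 gx κ Φ t p O.merged) (KS.fT 0 fx κ Φ t p O.merged) ≤ Rπ κ Φ t p O.merged (KS.gT 0 gx κ Φ t p O.merged) (KS.fT 0 fx κ Φ t p O.merged) (SU exR mx) q := ex_le_Rπ κ Φ t p O.merged (KS.gT 0 gx κ Φ t p O.merged) (KS.fT 0 fx κ Φ t p O.merged) exR mx q hfloors.2.2.1
  have hΛR := KS.hΛR_R κ Φ t p O.merged (KS.gT 0 gx κ Φ t p O.merged) (KS.fT 0 fx κ Φ t p O.merged) 0 hN hσ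
  have hΛQ := KS.hΛQ_R κ Φ t p O.merged (KS.gT 0 gx κ Φ t p O.merged) (KS.fT 0 fx κ Φ t p O.merged) 0
  have hkR0 := KS.hkR0_R κ Φ t p O.merged (KS.gT 0 gx κ Φ t p O.merged) (KS.fT 0 fx κ Φ t p O.merged) 0 hN
  have hkR1 := KS.hkR1_R κ Φ t p O.merged (KS.gT 0 gx κ Φ t p O.merged) (KS.fT 0 fx κ Φ t p O.merged) 0 hN
  have hfR := KS.hfR_R κ Φ t p O.merged 0 gx (f := (KS.fT 0 fx κ Φ t p O.merged)) hN hκ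
  have hRn := KS.hRn_R κ Φ t p O.merged 0 gx fx
  have hclr₁ := KS.hclr₁_R κ Φ t p O.merged 0 gx fx hkM₀ (sgOf ((0 : Fin 2), sδ))
  have hB0 := KS.hB0_R κ Φ t p O.merged (KS.gT 0 gx κ Φ t p O.merged) (KS.fT 0 fx κ Φ t p O.merged) 0 (sgOf ((0 : Fin 2), sδ))
  have hfrB := KS.frames_B₀_eq κ Φ t p O.merged (KS.gT 0 gx κ Φ t p O.merged) (KS.fT 0 fx κ Φ t p O.merged) 0 (sgOf ((0 : Fin 2), sδ))
  have hregB := KS.region_eq_tr κ Φ t p O.merged (KS.gT 0 gx κ Φ t p O.merged) (KS.fT 0 fx κ Φ t p O.merged) 0 (sgOf ((0 : Fin 2), sδ))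
  have hc1 := KS.core1Lo_l1 κ Φ t p O.merged (KS.gT 0 gx κ Φ t p O.merged) (KS.fT 0 fx κ Φ t p O.merged) hσ hℓb27
  have hyl := KS.yL_l1 κ Φ t p O.merged (KS.gT 0 gx κ Φ t p O.merged) (KS.fT 0 fx κ Φ t p O.merged) hσ hℓb27
  have hRb₀ : KS.r₀A Φ t O.merged 0 (Rb κ Φ t p O.merged) ≤ Rπ κ Φ t p O.merged (KS.gT 0 gx κ Φ t p O.merged) (KS.fT 0 fx κ Φ t p O.merged) (SU exR mx) q := ex_le_Rπ κ Φ t p O.merged (KS.gT 0 gx κ Φ t p O.merged) (KS.fT 0 fx κ Φ t p O.merged) exR mx q hfloors.1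
  have hRr₀ : KS.r₀A Φ t O.merged 0 (Rl κ Φ t p O.merged (KS.gT 0 gx κ Φ t p O.merged) (KS.fT 0 fx κ Φ t p O.merged)) ≤ Rπ κ Φ t p O.merged (KS.gT 0 gx κ Φ t p O.merged) (KS.fT 0 fx κ Φ t p O.merged) (SU exR mx) q := ex_le_Rπ κ Φ t p O.merged (KS.gT 0 gx κ Φ t p O.merged) (KS.fT 0 fx κ Φ t p O.merged) exR mx q hfloors.2.1
  have hRbπ : Rb κ Φ t p O.merged ≤ Rπ κ Φ t p O.merged (KS.gT 0 gx κ Φ t p O.merged) (KS.fT 0 fx κ Φ t p O.merged) (SU exR mx) q := ex_le_Rπ κ Φ t p O.merged (KS.gT 0 gx κ Φ t p O.merged) (KS.fT 0 fx κ Φ t p O.merged) exR mx q hfloors.2.2.2.1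
  have hR₁b := Rex_fat_le_Rπ_sub κ Φ t p O.merged (KS.gT 0 gx κ Φ t p O.merged) (KS.fT 0 fx κ Φ t p O.merged) exR mx q hC hfloors.1
  have hR₁r := Rex_fat_le_Rπ_sub κ Φ t p O.merged (KS.gT 0 gx κ Φ t p O.merged) (KS.fT 0 fx κ Φ t p O.merged) exR mx q hC hfloors.2.1
  have hbOK := Skelφ.bridgeOK_all hσ (nL κ Φ t p O.merged (KS.gT 0 gx κ Φ t p O.merged) (KS.fT 0 fx κ Φ t p O.merged)) (hL κ Φ t p O.merged (KS.gT 0 gx κ Φ t p O.merged) (KS.fT 0 fx κ Φ t p O.merged)) (ℓL κ Φ t p O.merged (KS.gT 0 gx κ Φ t p O.merged) (KS.fT 0 fx κ Φ t p O.merged)) (KS.RA' κ Φ t p O.merged 0)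
    (KS.nBR κ Φ t p O.merged 0) (KS.hBR κ Φ t p O.merged 0) hℓb3
  -- reach numbers inside the window: `X + 1 ≤ exR` via `Yb`
  have hπ_of : ∀ {X Nr : ℕ}, X ≤ Yb κ Φ t p O.merged (KS.gT 0 gx κ Φ t p O.merged) (KS.fT 0 fx κ Φ t p O.merged) → 0 + 1 + Nr ≤ 1000 →
      X + (Nr + 1) * Skelφ.shearUnit (nL κ Φ t p O.merged (KS.gT 0 gx κ Φ t p O.merged) (KS.fT 0 fx κ Φ t p O.merged)) (hL κ Φ t p O.merged (KS.gT 0 gx κ Φ t p O.merged) (KS.fT 0 fx κ Φ t p O.merged)) ≤ Rπ κ Φ t p O.merged (KS.gT 0 gx κ Φ t p O.merged) (KS.fT 0 fx κ Φ t p O.merged) (SU exR mx) q := by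
    intro X Nr hX hNr
    refine ex_le_Rπ κ Φ t p O.merged (KS.gT 0 gx κ Φ t p O.merged) (KS.fT 0 fx κ Φ t p O.merged) exR mx q ?_
    have h5 := hfloors.2.2.2.2.1
    have hm : (Nr + 1) * Skelφ.shearUnit (nL κ Φ t p O.merged (KS.gT 0 gx κ Φ t p O.merged) (KS.fT 0 fx κ Φ t p O.merged)) (hL κ Φ t p O.merged (KS.gT 0 gx κ Φ t p O.merged) (KS.fT 0 fx κ Φ t p O.merged)) ≤ 1000 * Skelφ.shearUnit (nL κ Φ t p O.merged (KS.gT 0 gx κ Φ t p O.merged) (KS.fT 0 fx κ Φ t p O.merged)) (hL κ Φ t p O.merged (KS.gT 0 gx κ Φ t p O.merged) (KS.fT 0 fx κ Φ t p O.merged)) :=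
      Nat.mul_le_mul_right _ (by omega)
    omega
  have hπ1_of : ∀ {X : ℕ}, X ≤ Yb κ Φ t p O.merged (KS.gT 0 gx κ Φ t p O.merged) (KS.fT 0 fx κ Φ t p O.merged) → X ≤ Rπ κ Φ t p O.merged (KS.gT 0 gx κ Φ t p O.merged) (KS.fT 0 fx κ Φ t p O.merged) (SU exR mx) q := by
    intro X hX
    refine ex_le_Rπ κ Φ t p O.merged (KS.gT 0 gx κ Φ t p O.merged) (KS.fT 0 fx κ Φ t p O.merged) exR mx q ?_
    have h5 := hfloors.2.2.2.2.1
    omega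
  have hℓb27' : 2 * KS.bR κ Φ t p O.merged 0 + 27 ≤ KS.ℓBR κ Φ t p O.merged 0 := KS.ℓBR_ge κ Φ t p O.merged 0 _ hEb
  -- ### the three bridge cases
  rcases hφcase with hob | htr
  · -- #### case `o_b = o_L`: the bridge is the x side half of `φL`
    have hφ : oriφ Φ.φ (O.ori t (KS.MBR κ Φ t p O.merged 0) (KS.nBR κ Φ t p O.merged 0)) = φL κ Φ t p O.D O.DT O.ori (KS.gT 0 gx κ Φ t p O.merged) (KS.fT 0 fx κ Φ t p O.merged) := by
      unfold NegB.φL; rw [hob]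
    have hNr := (KS.NrOf_spec κ Φ t p O.merged (KS.gT 0 gx κ Φ t p O.merged) (KS.fT 0 fx κ Φ t p O.merged) hN hσ (KS.yLs κ Φ t p O.merged (KS.gT 0 gx κ Φ t p O.merged) (KS.fT 0 fx κ Φ t p O.merged) 0 (sgOf ((0 : Fin 2), sδ))) hΛ3.1.1).1
    obtain ⟨hQb, hFb, hFZ, hbridge⟩ := Skelφ.bridgeData_same t hσ (nL κ Φ t p O.merged (KS.gT 0 gx κ Φ t p O.merged) (KS.fT 0 fx κ Φ t p O.merged)) (hL κ Φ t p O.merged (KS.gT 0 gx κ Φ t p O.merged) (KS.fT 0 fx κ Φ t p O.merged)) (ℓL κ Φ t p O.merged (KS.gT 0 gx κ Φ t p O.merged) (KS.fT 0 fx κ Φ t p O.merged)) (KS.RA' κ Φ t p O.merged 0)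
      hnb (KS.hBR κ Φ t p O.merged 0) (KS.ℓBR κ Φ t p O.merged 0) (Rb κ Φ t p O.merged) (KS.vBR κ Φ t p O.merged 0) hZ (hservedB hNr) hMzb hφ
    exact rootOblTWAt_negBT_x hAt h1 hp0 hp1 ((0 : Fin 2), sδ) 0 _ (KS.qBs κ Φ t p O.merged 0) _ (Rb κ Φ t p O.merged) hNr
      (KS.yLs κ Φ t p O.merged (KS.gT 0 gx κ Φ t p O.merged) (KS.fT 0 fx κ Φ t p O.merged) 0 (sgOf ((0 : Fin 2), sδ))) (mx κ Φ t p O.merged (KS.gT 0 gx κ Φ t p O.merged) (KS.fT 0 fx κ Φ t p O.merged))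
      (KS.kit_mem_PR κ Φ t p O.merged 0 Px) hRQ hRB hRQ' hRM hΛRg hkA0 hkA1 ⟨hkAQ' 0, hkAQ' 1⟩ hρπ _ hbOK.1 le_rfl _ _ hQb hFb hFZ hbridge
      hB0 hRlπ hΛR hΛQ.1 hΛQ.2 hkR0 hkR1 (fun _ => hfR.1) (fun h => absurd h Fin.zero_ne_one) (KS.hprism_R κ Φ t p O.merged (KS.gT 0 gx κ Φ t p O.merged) (KS.fT 0 fx κ Φ t p O.merged) 0 _ _) (KS.hlastc_R κ Φ t p O.merged (KS.gT 0 gx κ Φ t p O.merged) (KS.fT 0 fx κ Φ t p O.merged) 0 _ _)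
      (Skelφ.pt_zero _ _).le (Skelφ.pt_zero _ _).ge (Skelφ.pt_one _ _).le (Skelφ.pt_one _ _).ge
      (fun h => KS.hPf₁_R κ Φ t p O.merged 0 gx fx hN hκ _ _ hq4s hΛ3.1.1 h) (fun h => KS.hPf₂_R κ Φ t p O.merged 0 gx fx hN hκ _ _ hq4s hΛ3.1.1 h)
      (KS.hPf₃_R κ Φ t p O.merged 0 gx fx hN hκ _ _ hq4s hΛ3.1.1 hΛ3.1.2 hσ)
      (Skelφ.pt_zero _ _).le (Skelφ.pt_zero _ _).ge (Skelφ.pt_one _ _).le (Skelφ.pt_one _ _).ge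
      (fun h => KS.hLg₁_R κ Φ t p O.merged 0 gx fx hN hκ _ _ hq4s hΛ3.1.1 h) (fun h => KS.hLg₂_R κ Φ t p O.merged 0 gx fx hN hκ _ _ hq4s hΛ3.1.1 h)
      (KS.hLg₃_R κ Φ t p O.merged 0 gx fx hN hκ _ _ hq4s hΛ3.1.1 hΛ3.1.2 hσ)
      (KS.hxa_s κ Φ t p O.merged (KS.gT 0 gx κ Φ t p O.merged) (KS.fT 0 fx κ Φ t p O.merged) 0 hσ) (KS.hxb_s κ Φ t p O.merged 0 gx fx hN hκ hσ) (KS.hclr_s κ Φ t p O.merged (KS.gT 0 gx κ Φ t p O.merged) (KS.fT 0 fx κ Φ t p O.merged) 0 hσ) hRn hclr₁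
      (hπ1_of hc1.1) (hπ_of hyl.1 hNr) hRb₀ hRr₀ hRbπ hR₁b hR₁r
  · rcases Nat.lt_or_ge (KS.ℓBR κ Φ t p O.merged 0) (2 * (KS.hBR κ Φ t p O.merged 0).natAbs) with hside | htop
    · -- #### case `o_b ≠ o_L`, steep: the bridge is a side half of `trφ φL`
      have hNr := (KS.NrOf_spec κ Φ t p O.merged (KS.gT 0 gx κ Φ t p O.merged) (KS.fT 0 fx κ Φ t p O.merged) hN hσ (KS.yLd κ Φ t p O.merged (KS.gT 0 gx κ Φ t p O.merged) (KS.fT 0 fx κ Φ t p O.merged) 0 (sgOf ((0 : Fin 2), sδ))) hΛ3.2.1.1).1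
      obtain ⟨hQb, hFb, hFZ, hbridge⟩ := Skelφ.bridgeData_trSide t hσ (nL κ Φ t p O.merged (KS.gT 0 gx κ Φ t p O.merged) (KS.fT 0 fx κ Φ t p O.merged)) (hL κ Φ t p O.merged (KS.gT 0 gx κ Φ t p O.merged) (KS.fT 0 fx κ Φ t p O.merged)) (ℓL κ Φ t p O.merged (KS.gT 0 gx κ Φ t p O.merged) (KS.fT 0 fx κ Φ t p O.merged)) (KS.RA' κ Φ t p O.merged 0)
        hnb (KS.hBR κ Φ t p O.merged 0) (KS.ℓBR κ Φ t p O.merged 0) (Rb κ Φ t p O.merged) (KS.vBR κ Φ t p O.merged 0) hZ (hservedB hNr) hMzb htr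
      exact rootOblTWAt_negBT_x hAt h1 hp0 hp1 ((0 : Fin 2), sδ) 0 _ (KS.qBd κ Φ t p O.merged 0) _ (Rb κ Φ t p O.merged) hNr
        (KS.yLd κ Φ t p O.merged (KS.gT 0 gx κ Φ t p O.merged) (KS.fT 0 fx κ Φ t p O.merged) 0 (sgOf ((0 : Fin 2), sδ))) (mx κ Φ t p O.merged (KS.gT 0 gx κ Φ t p O.merged) (KS.fT 0 fx κ Φ t p O.merged))
        (KS.kit_mem_PR κ Φ t p O.merged 0 Px) hRQ hRB hRQ' hRM hΛRg hkA0 hkA1 ⟨hkAQ' 0, hkAQ' 1⟩ hρπ _ hbOK.2.1 (le_of_eq hfrB.2.2.2.2.1.symm) _ _ hQb hFb hFZ hbridge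
        (by rw [hfrB.1, hfrB.2.1]; exact hB0) hRlπ (by rw [hregB.1, hregB.2.1]; exact hΛR) hΛQ.1 hΛQ.2 hkR0 hkR1 (fun _ => hfR.1) (fun h => absurd h Fin.zero_ne_one)
        (KS.hprism_R κ Φ t p O.merged (KS.gT 0 gx κ Φ t p O.merged) (KS.fT 0 fx κ Φ t p O.merged) 0 _ _) (KS.hlastc_R κ Φ t p O.merged (KS.gT 0 gx κ Φ t p O.merged) (KS.fT 0 fx κ Φ t p O.merged) 0 _ _)
        (Skelφ.pt_zero _ _).le (Skelφ.pt_zero _ _).ge (Skelφ.pt_one _ _).le (Skelφ.pt_one _ _).ge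
        (fun h => KS.hPf₁_R κ Φ t p O.merged 0 gx fx hN hκ _ _ hq4dt.1 hΛ3.2.1.1 h) (fun h => KS.hPf₂_R κ Φ t p O.merged 0 gx fx hN hκ _ _ hq4dt.1 hΛ3.2.1.1 h)
        (KS.hPf₃_R κ Φ t p O.merged 0 gx fx hN hκ _ _ hq4dt.1 hΛ3.2.1.1 hΛ3.2.1.2 hσ)
        (Skelφ.pt_zero _ _).le (Skelφ.pt_zero _ _).ge (Skelφ.pt_one _ _).le (Skelφ.pt_one _ _).ge
        (fun h => KS.hLg₁_R κ Φ t p O.merged 0 gx fx hN hκ _ _ hq4dt.1 hΛ3.2.1.1 h) (fun h => KS.hLg₂_R κ Φ t p O.merged 0 gx fx hN hκ _ _ hq4dt.1 hΛ3.2.1.1 h)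
        (KS.hLg₃_R κ Φ t p O.merged 0 gx fx hN hκ _ _ hq4dt.1 hΛ3.2.1.1 hΛ3.2.1.2 hσ)
        (KS.hxa_d κ Φ t p O.merged (KS.gT 0 gx κ Φ t p O.merged) (KS.fT 0 fx κ Φ t p O.merged) 0 hσ) (KS.hxb_d κ Φ t p O.merged 0 gx fx hN hκ hσ) (KS.hclr_d κ Φ t p O.merged (KS.gT 0 gx κ Φ t p O.merged) (KS.fT 0 fx κ Φ t p O.merged) 0 hσ hside hℓb27') hRn
        (by rw [hfrB.1, hfrB.2.2.2.2.1, hfrB.2.2.2.2.2.2.2.1]; exact hclr₁)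
        (hπ1_of hc1.2.1) (hπ_of hyl.2.1 hNr) hRb₀ hRr₀ hRbπ hR₁b hR₁r
    · -- #### case `o_b ≠ o_L`, flat: the bridge is a top piece of `trφ φL`
      have hNr := (KS.NrOf_spec κ Φ t p O.merged (KS.gT 0 gx κ Φ t p O.merged) (KS.fT 0 fx κ Φ t p O.merged) hN hσ (KS.yLt κ Φ t p O.merged (KS.gT 0 gx κ Φ t p O.merged) (KS.fT 0 fx κ Φ t p O.merged) 0 (sgOf ((0 : Fin 2), sδ))) hΛ3.2.2.1).1
      obtain ⟨hQb, hFb, hFZ, hbridge⟩ := Skelφ.bridgeData_trTop t hσ (nL κ Φ t p O.merged (KS.gT 0 gx κ Φ t p O.merged) (KS.fT 0 fx κ Φ t p O.merged)) (hL κ Φ t p O.merged (KS.gT 0 gx κ Φ t p O.merged) (KS.fT 0 fx κ Φ t p O.merged)) (ℓL κ Φ t p O.merged (KS.gT 0 gx κ Φ t p O.merged) (KS.fT 0 fx κ Φ t p O.merged)) (KS.RA' κ Φ t p O.merged 0)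
        hnb (KS.hBR κ Φ t p O.merged 0) (KS.ℓBR κ Φ t p O.merged 0) (Rb κ Φ t p O.merged) (KS.vBR κ Φ t p O.merged 0) hZ (hservedB hNr) htr hκb hclrb
      exact rootOblTWAt_negBT_x hAt h1 hp0 hp1 ((0 : Fin 2), sδ) 0 _ (KS.qBt κ Φ t p O.merged 0) _ (Rb κ Φ t p O.merged) hNr
        (KS.yLt κ Φ t p O.merged (KS.gT 0 gx κ Φ t p O.merged) (KS.fT 0 fx κ Φ t p O.merged) 0 (sgOf ((0 : Fin 2), sδ))) (mx κ Φ t p O.merged (KS.gT 0 gx κ Φ t p O.merged) (KS.fT 0 fx κ Φ t p O.merged))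
        (KS.kit_mem_PR κ Φ t p O.merged 0 Px) hRQ hRB hRQ' hRM hΛRg hkA0 hkA1 ⟨hkAQ' 0, hkAQ' 1⟩ hρπ _ hbOK.2.2 (le_of_eq hfrB.2.2.2.2.2.1.symm) _ _ hQb hFb hFZ hbridge
        (by rw [hfrB.2.2.1, hfrB.2.2.2.1]; exact hB0) hRlπ (by rw [hregB.2.2.1, hregB.2.2.2]; exact hΛR) hΛQ.1 hΛQ.2 hkR0 hkR1 (fun _ => hfR.1) (fun h => absurd h Fin.zero_ne_one)
        (KS.hprism_R κ Φ t p O.merged (KS.gT 0 gx κ Φ t p O.merged) (KS.fT 0 fx κ Φ t p O.merged) 0 _ _) (KS.hlastc_R κ Φ t p O.merged (KS.gT 0 gx κ Φ t p O.merged) (KS.fT 0 fx κ Φ t p O.merged) 0 _ _)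
        (Skelφ.pt_zero _ _).le (Skelφ.pt_zero _ _).ge (Skelφ.pt_one _ _).le (Skelφ.pt_one _ _).ge
        (fun h => KS.hPf₁_R κ Φ t p O.merged 0 gx fx hN hκ _ _ hq4dt.2 hΛ3.2.2.1 h) (fun h => KS.hPf₂_R κ Φ t p O.merged 0 gx fx hN hκ _ _ hq4dt.2 hΛ3.2.2.1 h)
        (KS.hPf₃_R κ Φ t p O.merged 0 gx fx hN hκ _ _ hq4dt.2 hΛ3.2.2.1 hΛ3.2.2.2 hσ)
        (Skelφ.pt_zero _ _).le (Skelφ.pt_zero _ _).ge (Skelφ.pt_one _ _).le (Skelφ.pt_one _ _).ge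
        (fun h => KS.hLg₁_R κ Φ t p O.merged 0 gx fx hN hκ _ _ hq4dt.2 hΛ3.2.2.1 h) (fun h => KS.hLg₂_R κ Φ t p O.merged 0 gx fx hN hκ _ _ hq4dt.2 hΛ3.2.2.1 h)
        (KS.hLg₃_R κ Φ t p O.merged 0 gx fx hN hκ _ _ hq4dt.2 hΛ3.2.2.1 hΛ3.2.2.2 hσ)
        (KS.hxa_t κ Φ t p O.merged (KS.gT 0 gx κ Φ t p O.merged) (KS.fT 0 fx κ Φ t p O.merged) 0 hσ) (KS.hxb_t κ Φ t p O.merged 0 gx fx hN hκ hσ htop) (KS.hclr_t κ Φ t p O.merged (KS.gT 0 gx κ Φ t p O.merged) (KS.fT 0 fx κ Φ t p O.merged) 0 hσ htop hℓb27') hRn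
        (by rw [hfrB.2.2.1, hfrB.2.2.2.2.2.1, hfrB.2.2.2.2.2.2.2.2.1]; exact hclr₁)
        (hπ1_of hc1.2.2) (hπ_of hyl.2.2 hNr) hRb₀ hRr₀ hRbπ hR₁b hR₁r

end AtR

end NegB

end PlanarSkeletonNeg

end Summit.CriticalPhenomena.PercolationContinuityZ3.Theorems.Transplant

end
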